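import Summits.MatrixMultiplication.MatrixMultiplication.Theorems.AbelianSTPPCensusShapeCertVQKGSearch
import Summits.MatrixMultiplication.MatrixMultiplication.Theorems.AbelianSTPPCensusShapeCertVQKSearchP

/-!
# Abelian STPP census — soundness of `ShapeCertVQ.checkQKG`, part 3: how the path segments assemble

Cell mm-stpp, rung F-M1; census-silent kernel ENABLER for the tranche-2 device band on `T_E` (vQKG := vP ∧ E3⁺ ∧ E3K ∧ U11-G′), in support
of the closed crux item stmt-MatrixMultiplication-19191; seat mm-stpp-vp-p2 (gen 9).  Pure bookkeeping about the Boolean search of `…VQKGDefs`,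
VERBATIM after vp-p2 g3's `…ShapeCertVQKSearchP` (g2's segment lemmas `segOutS_append`, `loopS_of_segOutS`, `segInS_append`, `segInS_eq_innerS`,
`pathNodeS_block_lt` are reused — the walks and pools are g2's):
* `dfsKG_of_nodeOutS` / `dfsKG_of_nodeDec` — one level of `dfsKG` from the node-level decision `nodeDecKG` and a long enough outer segment;
* `pathOutKG_append`, `pathInKG_append`, `pathOKKG_of_out` (outer segments covering the pool give the node, `PathOKKG`),
  `pathOutKG_single_of_in`, `pathInKG_single_of_child`, `checkQKG_of_pathOKKG_nil` (the root node is `checkQKG M`).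
So an order is certified by kernel-evaluating a tree of `pathOutKG` / `pathInKG` facts and folding them with these lemmas (seat generator, after a
band is registered — not in this file).
WHAT THIS IS NOT: no statement about STPP families or `ω`; no census number, no order range.
-/

set_option linter.dupNamespace false -- `MatrixMultiplication.MatrixMultiplication` (summit = problem, D-0017)
set_option autoImplicit false

namespace Summit.MatrixMultiplication.MatrixMultiplication.Theorems.ShapeCertVQ

open ShapeCert ShapeCertVP

section node
variable {M : ℕ}

/-- **one level of the search from its pieces**: if the node-level decision is open and an outer segment longer than the pool passes,
the node passes -/
theorem dfsKG_of_nodeOutS (ds : List ℕ) (fuel : ℕ) (fam : List Sh) (B : List (List Sh)) {n : ℕ} (hn : B.length < n)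
    (hdec : nodeDecKG M ds fam = none) (h : nodeOutS M (dfsKG M ds fuel) fam n B = true) :
    dfsKG M ds (fuel + 1) fam B = true := by
  rw [dfsKG]
  unfold nodeDecKG at hdec
  unfold nodeOutS at h
  simp only [Agg.force_eq, seqN_eq] at hdec h ⊢
  by_cases h1 : killEKG ds M (aggOf M fam) fam = true
  · rw [if_pos h1] at hdec; exact absurd hdec (by simp)
  rw [if_neg h1] at hdec ⊢
  by_cases h2 : M * D < (aggOf M fam).gs
  · rw [if_pos h2] at hdec; exact absurd hdec (by simp)
  rw [if_neg h2] at hdec ⊢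
  by_cases h3 : (aggOf M fam).dead M = true
  · rw [if_pos h3] at hdec; exact absurd hdec (by simp)
  rw [if_neg h3] at hdec ⊢
  by_cases h4 : (budsOf M (aggOf M fam) fam).tailEmpty = true
  · rw [if_pos h4] at hdec; exact absurd hdec (by simp)
  rw [if_neg h4] at hdec ⊢
  by_cases h5 : ((gnodeQ (headLevQ fam) (budsOf M (aggOf M fam) fam)).ok &&
      decide ((aggOf M fam).gs * K + (gnodeQ (headLevQ fam) (budsOf M (aggOf M fam) fam)).bud *
        (tabGQ (headLevQ fam)).get (gnodeQ (headLevQ fam) (budsOf M (aggOf M fam) fam)).idx ≤ M * D * K)) = true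
  · rw [if_pos h5] at hdec; exact absurd hdec (by simp)
  rw [if_neg h5]
  exact loopS_of_segOutS n B hn h

/-- a decided node -/
theorem dfsKG_of_nodeDec (ds : List ℕ) (fuel : ℕ) (fam : List Sh) (B : List (List Sh)) (hdec : nodeDecKG M ds fam = some true) :
    dfsKG M ds (fuel + 1) fam B = true := by
  rw [dfsKG]
  unfold nodeDecKG at hdec
  simp only [Agg.force_eq, seqN_eq] at hdec ⊢
  by_cases h1 : killEKG ds M (aggOf M fam) fam = true
  · rw [if_pos h1]
  rw [if_neg h1] at hdec ⊢
  by_cases h2 : M * D < (aggOf M fam).gs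
  · rw [if_pos h2] at hdec; exact absurd hdec (by simp)
  rw [if_neg h2] at hdec ⊢
  by_cases h3 : (aggOf M fam).dead M = true
  · rw [if_pos h3]
  rw [if_neg h3] at hdec ⊢
  by_cases h4 : (budsOf M (aggOf M fam) fam).tailEmpty = true
  · rw [if_pos h4] at hdec ⊢; simpa using hdec
  rw [if_neg h4] at hdec ⊢
  by_cases h5 : ((gnodeQ (headLevQ fam) (budsOf M (aggOf M fam) fam)).ok &&
      decide ((aggOf M fam).gs * K + (gnodeQ (headLevQ fam) (budsOf M (aggOf M fam) fam)).bud *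
        (tabGQ (headLevQ fam)).get (gnodeQ (headLevQ fam) (budsOf M (aggOf M fam) fam)).idx ≤ M * D * K)) = true
  · rw [if_pos h5]
  rw [if_neg h5] at hdec; exact absurd hdec (by simp)

end node

section paths
variable {M : ℕ}

/-- **consecutive outer segments of one node concatenate** -/
theorem pathOutKG_append {path : List (ℕ × ℕ)} {i n m : ℕ} (h1 : pathOutKG M path i n = true)
    (h2 : pathOutKG M path (i + n) m = true) : pathOutKG M path i (n + m) = true := by
  unfold pathOutKG at h1 h2 ⊢
  simp only [seqL_eq] at h1 h2 ⊢
  cases hdec : nodeDecKG M (divsQ M) (pathNodeS M path).1 with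
  | some v => simpa [hdec] using h1
  | none =>
    simp only [hdec] at h1 h2 ⊢
    unfold nodeOutS at h1 h2 ⊢
    simp only [Agg.force_eq, seqN_eq] at h1 h2 ⊢
    rw [← List.drop_drop] at h2
    exact segOutS_append n m _ h1 h2

/-- **outer segments covering the whole pool of a node give the node** -/
theorem pathOKKG_of_out {path : List (ℕ × ℕ)} {n : ℕ} (h : pathOutKG M path 0 n = true) (hn : ((pathNodeS M path).2).length < n)
    (hd : path.length ≤ M + 1) : PathOKKG M path := by
  unfold PathOKKG
  rw [show M + 2 - path.length = (M + 1 - path.length) + 1 by omega]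
  unfold pathOutKG at h
  simp only [seqL_eq] at h
  rw [List.drop_zero] at h
  cases hdec : nodeDecKG M (divsQ M) (pathNodeS M path).1 with
  | some v =>
    simp only [hdec] at h
    subst h
    exact dfsKG_of_nodeDec _ _ _ _ hdec
  | none =>
    simp only [hdec] at h
    exact dfsKG_of_nodeOutS _ _ _ _ hn hdec h

/-- **consecutive inner segments of one block concatenate** -/
theorem pathInKG_append {path : List (ℕ × ℕ)} {i j n m : ℕ} (h1 : pathInKG M path i j n = true)
    (h2 : pathInKG M path i (j + n) m = true) : pathInKG M path i j (n + m) = true := by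
  unfold pathInKG at h1 h2 ⊢
  simp only [seqL_eq] at h1 h2 ⊢
  cases hdec : nodeDecKG M (divsQ M) (pathNodeS M path).1 with
  | some v => simpa [hdec] using h1
  | none =>
    simp only [hdec] at h1 h2 ⊢
    cases hdi : ((pathNodeS M path).2).drop i with
    | nil => simp
    | cons b bs =>
      simp only [hdi] at h1 h2
      dsimp only
      unfold nodeInS at h1 h2 ⊢
      simp only [Agg.force_eq, seqN_eq] at h1 h2 ⊢
      rw [← List.drop_drop] at h2
      exact segInS_append n m _ h1 h2

/-- **inner segments covering block `i` give the one-block outer segment** (`i` a block index of the pool, the segments reaching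
past `9999` members) -/
theorem pathOutKG_single_of_in {path : List (ℕ × ℕ)} {i n : ℕ} (h : pathInKG M path i 0 n = true)
    (hi : i < ((pathNodeS M path).2).length) (hn : 9999 ≤ n) : pathOutKG M path i 1 = true := by
  unfold pathInKG at h
  unfold pathOutKG
  simp only [seqL_eq] at h ⊢
  cases hdec : nodeDecKG M (divsQ M) (pathNodeS M path).1 with
  | some v => simpa [hdec] using h
  | none =>
    simp only [hdec] at h ⊢
    cases hdi : ((pathNodeS M path).2).drop i with
    | nil =>
      exfalso
      have := List.drop_eq_nil_iff.mp hdi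
      omega
    | cons b bs =>
      simp only [hdi, List.drop_zero] at h
      have hb : b.length < n :=
        lt_of_lt_of_le (pathNodeS_block_lt M path b (List.mem_of_mem_drop (by rw [hdi]; simp))) hn
      unfold nodeOutS
      unfold nodeInS at h
      simp only [Agg.force_eq, seqN_eq] at h ⊢
      cases b with
      | nil => rw [segOutS, segOutS]
      | cons t r =>
        rw [segOutS]
        split_ifs with hbr hcap
        · rfl
        · rw [segOutS]
        · rw [segOutS, Bool.and_true, ← segInS_eq_innerS n _ hb]
          exact h

/-- **a node gives the one-member inner segment of its parent** (an evaluated sibling inner segment of the same node vouches for the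
parent's node-level decision) -/
theorem pathInKG_single_of_child {path : List (ℕ × ℕ)} {i j j' m : ℕ} (hsib : pathInKG M path i j' m = true)
    (hchild : PathOKKG M ((i, j) :: path)) (hd : path.length ≤ M) : pathInKG M path i j 1 = true := by
  unfold PathOKKG at hchild
  have hfuel : M + 2 - ((i, j) :: path).length = (M - path.length) + 1 := by simp only [List.length_cons]; omega
  rw [hfuel] at hchild
  unfold pathInKG at hsib ⊢
  simp only [seqL_eq] at hsib ⊢
  cases hdec : nodeDecKG M (divsQ M) (pathNodeS M path).1 with
  | some v => simpa [hdec] using hsib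
  | none =>
    simp only [hdec] at hsib ⊢
    have hrec : M + 1 - path.length = (M - path.length) + 1 := by omega
    cases hdi : ((pathNodeS M path).2).drop i with
    | nil => simp
    | cons b bs =>
      dsimp only
      rw [hrec]
      cases hdj : b.drop j with
      | nil =>
        unfold nodeInS
        simp only [Agg.force_eq, seqN_eq]
        rw [segInS]
      | cons t r =>
        have hnode : pathNodeS M ((i, j) :: path) = (t :: (pathNodeS M path).1, (t :: r) :: bs) := by
          rw [pathNodeS, hdi]; simp only; rw [hdj]
        rw [hnode] at hchild
        simp only at hchild
        unfold nodeInS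
        simp only [Agg.force_eq, seqN_eq]
        rw [segInS]
        split_ifs with hbr hsk
        · rfl
        · rw [segInS]
        · rw [segInS, Bool.and_true]
          unfold stepS
          simp only [Agg.force_eq, seqN_eq]
          split_ifs <;> first | rfl | exact hchild

/-- **the root node is the certificate** -/
theorem checkQKG_of_pathOKKG_nil (h : PathOKKG M []) : checkQKG M = true := by
  unfold PathOKKG at h; simpa [pathNodeS, checkQKG] using h

end paths

end Summit.MatrixMultiplication.MatrixMultiplication.Theorems.ShapeCertVQ
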